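import Literature.MathematicalPhysics.QuantumFieldTheory.Balaban1983to89.B9Thm39WholeBlkVia

/-!
# `Balaban1983to89.B9Thm39WholeBlkViaDatum` — [B9] Theorem 3.9 (rows 15–16 of the N06 knit) with the kernel expansion's TERMS read through the
# representative map `π` as well: the datum `EK39OfOpsBlkVia`, (3.99) for it, and rows 15 ∧ 16 at it (no site reads an empty fibre)

T. Bałaban, *Propagators for lattice gauge theories in a background field*, Commun. Math. Phys. **99** (1985) 389–434
[`Balaban1985BackgroundPropagators`, "B9"]; [4] = T. Bałaban, *Propagators and renormalization transformations for lattice gauge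
theories. II*, Commun. Math. Phys. **96** (1984) 223–250 [`Balaban1984PropagatorsII`].

statement-level skeleton of published theorems with citation tags; proofs where landed; nothing here is a claim about the
Yang–Mills mass gap

THE PRINTED LOCI (verbatim).  [B9] p. 413, Theorem 3.9: *"A term in this expansion corresponding to a walk ω … has the following bound:
|(R′₀(X₀)R′_{α₁}(X₁)·⋯·R′_{αₙ}(Xₙ))(y, y′)| ≦ O(1)(L^jη)^{−4}(L^{j′}η)^{−d}·O(M^{−1/2})^{|ω|}M^{−½|ω|}e^{−½δ₀d(ω,y,y′)}, y ∈ Λ_j, y′ ∈ Λ_{j′}. (3.99)  The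
distance d(ω, y, y′) is defined by (3.93), but the infimum is taken over yᵢ ∈ Xᵢ ∩ 𝔅."*;  [4] p. 231: *"d(x, x′) = d(y, y′) if x ∈ B^j(y), x′ ∈ B^{j′}(y′)"*;
[4] p. 248: *"We consider these operators on the L²-space defined by (2.69) with sites replaced by bonds"*.

WHY THIS FILE (successor of `B9Thm39WholeBlkVia`).  `B9Thm39WholeBlkVia` reads the CARRIER KERNEL through a representative map `π` of the geometry's
sites, but keeps the datum `EK39OfOpsBlk`, whose term kernels `kterm U ω y y′ := blockKer blk (ω-term) y y′ ∕ (L^{j′}η)^d` are read at the RAW sites; at the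
record (sites = index bonds, carrier fibred over ONE representative bond per block) a non-representative bond has an empty fibre, its `kterm` is 0 and
(3.99) is content-free there (referee ref-E's finding J2 on `B9Thm39WholeBlkFaces`).  THIS FILE reads the TERMS through `π` too: `EK39OfOpsBlkVia 𝔬 rd d B₁ δ₁ π`
has `kterm U ω y y′ := blockKer blk (ω-term) (π y) (π y′) ∕ (L^{j′}η)^d` — the (y, y′) entry of the ω-term IS the block norm between the carrier blocks of y and
y′ (print: *"(…)(y, y′), y ∈ Λ_j, y′ ∈ Λ_{j′}"* — a function of the BLOCKS), so NO site is content-free — and proves (3.99) for it from the same schemas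
(`kterm_EK39OfOpsBlkVia_le`: the carrier bound at (π y, π y′), transported by the π-invariance of `len`, of the distances from∕to a site, hence of the walk
distance (3.93) `minLen` — `minLen_congr_left ∕ _right`).  Rows 15 ∧ 16 at this datum and at the reading `KerReadsLeVia` follow as in `…BlkVia`.

* §1 `minLen_congr_left`, `minLen_congr_right` ((3.93) depends on the end-points only through their distances).
* §2 ★ `EK39OfOpsBlkVia` (`converges_EK39OfOpsBlkVia` = `Conv348Blk`, `locDep_EK39OfOpsBlkVia`, ★ `kterm_EK39OfOpsBlkVia_le` = (3.99)).
* §3 `thm39Printed_of_local348BlkVia` (row 15 at the datum, generic (2.61) constants), `thm39Printed_rowConst261BlkVia_of_rowSum261`,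
  `thm39_and_kernelSum_rowConst261BlkViaDatum_of_rowSum261`, `thm39_and_kernelSum_of_pin_rowConst261BlkViaDatum`, `thm32Printed_of_pin_rowConst261BlkViaDatum`.
* §4 ★ `t39_hksum_of_pin_rowConst261BlkViaDatum` over def-Y's operator-layer signature.

HONEST SCOPE.  As `B9Thm39WholeBlkVia`: every Theorem-3.9 schema and the reading stay DISPLAYED hypotheses of printed shape; nothing of [B9] or [4] asserted;
NOT a node discharge; count-neutral; one finite 𝕋⁴ programme — nothing continuum, nothing about the mass gap.  Cell `pub-ymgap` (HUMAN RULING D-0062),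
Track A node N06 [B9], seat `pub-ymgap-dag-n06-j` (harness re-seat gen 5), 2026-08-27.
-/

namespace Literature.MathematicalPhysics.QuantumFieldTheory.Balaban1983to89.B9Thm39WholeBlkViaDatum

open Literature.MathematicalPhysics.QuantumFieldTheory.Balaban1983to89
open Finset B6RandomWalk B9Thm37Sum B9Thm34Ext B9Thm34Inv B9Thm39Sum B9Cor38Whole B9Thm39Whole B9Thm39WholeGeneric
open B6Lemma21Repaired B9Thm39WholeBlk B9Thm39WholeBlkFaces B9Thm39WholeBlkVia

noncomputable section

/-! ## §1 The walk distance (3.93) depends on the end-points only through their distances -/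

section MinLen

variable {St : Type}

/-- `minLen` is unchanged when the initial point is replaced by one with the same distances to everything. [cite: Balaban1985BackgroundPropagators, (3.93) p.410] -/
theorem minLen_congr_left (dd : St → St → ℝ) {a a' : St} (h : ∀ z, dd a' z = dd a z) :
    ∀ (n : ℕ) (S : ℕ → Finset St) (b : St), minLen dd S n a' b = minLen dd S n a b
  | 0, _, b => h b
  | n + 1, S, b => by
      simp only [minLen, h]

/-- `minLen` is unchanged when the final point is replaced by one with the same distances from everything. [cite: Balaban1985BackgroundPropagators, (3.93) p.410] -/
theorem minLen_congr_right (dd : St → St → ℝ) {b b' : St} (h : ∀ z, dd z b' = dd z b) :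
    ∀ (n : ℕ) (S : ℕ → Finset St) (a : St), minLen dd S n a b' = minLen dd S n a b
  | 0, _, a => h a
  | n + 1, S, a => by
      simp only [minLen, h, minLen_congr_right dd h n]

end MinLen

/-! ## §2 The datum with the terms read through `π`, its U-localisation clause and (3.99) -/

section OneMember

variable {g : B9.Geometry} [Fintype g.Site] [DecidableEq g.Site] {B : B9.Backgrounds} {X ι κ : Type} [Fintype ι] [Fintype X] [DecidableEq X]

omit [Fintype ι] in
/-- ★ **THE KERNEL EXPANSION DATUM OF THEOREM 3.9 OVER THE CARRIER, THE TERMS READ THROUGH THE REPRESENTATIVE MAP `π`**: as `EK39OfOpsBlk` except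
`kterm U ω y y′ := blockKer blk (ω-term) (π y) (π y′) ∕ (L^{j′}η)^d` — the (y, y′) kernel entry of the ω-term read at the carrier blocks of y and y′ (print:
the entries are indexed by the blocks y ∈ Λ_j, y′ ∈ Λ_{j′}; the record indexes them by bonds read at their carrier blocks, [4] p. 248).
[cite: Balaban1985BackgroundPropagators, Thm 3.9 (3.98)–(3.99) p.413 + (3.96) p.411 + (3.93) p.410; Balaban1984PropagatorsII, p.248] -/
def EK39OfOpsBlkVia (𝔬 : Ops39Blk g B X ι κ) (rd : WalkReading39 B ι κ) (d : ℕ) (B₁ δ₁ : ℝ) (π : g.Site → g.Site) :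
    B9.RWKernelExpansion g B where
  Walk := ℕ × ι × (ℕ → κ)
  wlen w := w.1
  wdist w y y' := minLen g.dist (walkSetsBlk 𝔬 w.2.1 w.2.2) w.1 y y'
  kterm U w y y' := blockKer 𝔬.blk (lprod (walkOpsBlk 𝔬 U w.2.1 w.2.2) w.1) (π y) (π y') / vol g d y'
  LocDep U w := ∀ U' : B.Cfg, rd.AgreeC w.2.1 U U' → (∀ k, 1 ≤ k → k ≤ w.1 → rd.Agree (w.2.2 k) U U') →
    lprod (walkOpsBlk 𝔬 U w.2.1 w.2.2) w.1 = lprod (walkOpsBlk 𝔬 U' w.2.1 w.2.2) w.1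
  Converges U := Conv348Blk 𝔬 B₁ δ₁ U

omit [Fintype ι] in
/-- The convergence predicate of `EK39OfOpsBlkVia` IS `Conv348Blk` (by `Iff.rfl`). [cite: Balaban1985BackgroundPropagators, (3.96) p.411] -/
theorem converges_EK39OfOpsBlkVia (𝔬 : Ops39Blk g B X ι κ) (rd : WalkReading39 B ι κ) (d : ℕ) (B₁ δ₁ : ℝ) (π : g.Site → g.Site) (U : B.Cfg) :
    (EK39OfOpsBlkVia 𝔬 rd d B₁ δ₁ π).Converges U ↔ Conv348Blk 𝔬 B₁ δ₁ U :=
  Iff.rfl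

omit [Fintype ι] in
/-- **The U-localisation clause of Theorem 3.9** at `EK39OfOpsBlkVia` (the same clause as at `EK39OfOpsBlk`), from `Locality39Blk`.
[cite: Balaban1985BackgroundPropagators, Thm 3.9 p.413] -/
theorem locDep_EK39OfOpsBlkVia (𝔬 : Ops39Blk g B X ι κ) (rd : WalkReading39 B ι κ) (d : ℕ) (B₁ δ₁ : ℝ) (π : g.Site → g.Site)
    (hloc : Locality39Blk 𝔬 rd) (U : B.Cfg) (w : ℕ × ι × (ℕ → κ)) : (EK39OfOpsBlkVia 𝔬 rd d B₁ δ₁ π).LocDep U w :=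
  locDep_EK39OfOpsBlk 𝔬 rd d B₁ δ₁ hloc U w

/-- ★ **THE BOUND (3.99) at the datum read through `π`**: for a representative map with `len (π y) = len y` and distances from∕to `π y` equal to those
from∕to `y` ([4] p. 231: the distance is a function of the blocks), |kterm U ω y y′| ≦ (L^jη)^{−4}(L^{j′}η)^{−d}·walkFactor(B₀, (θ₀c + 1)M^{−1/2}, M,
2(1 − α)δ₀)(|ω|, d(ω, y, y′)) — the carrier bound `kterm_EK39OfOpsBlk_le` at (π y, π y′) transported by the invariances (`minLen_congr_left ∕ _right`).
[cite: Balaban1985BackgroundPropagators, Thm 3.9 (3.99) p.413 + (3.93) p.410; Balaban1984PropagatorsII, (2.45)–(2.46) p.231 + Lemma 2.1 (2.61) p.234] -/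
theorem kterm_EK39OfOpsBlkVia_le (𝔬 : Ops39Blk g B X ι κ) (rd : WalkReading39 B ι κ) (c : ℝ) (d : ℕ)
    (B₁ δ₁ δ₀ α θ₀ B₀ N : ℝ) (π : g.Site → g.Site) (U : B.Cfg) (hc : 0 ≤ c) (hδ₀ : 0 ≤ δ₀) (hα : 0 ≤ α) (hα1 : α ≤ 1) (hθ₀ : 0 ≤ θ₀)
    (hB₀ : 0 ≤ B₀) (hM : 0 < g.M) (hs : StaticOK39Blk 𝔬 N) (h261 : Ineq261With c (b6 g) δ₀ α)
    (hπlen : ∀ y, g.len (π y) = g.len y) (hπl : ∀ y z, g.dist (π y) z = g.dist y z) (hπr : ∀ z y, g.dist z (π y) = g.dist z y)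
    (hl : Local348Blk 𝔬 B₀ δ₀ U) (hf : Factors389Blk 𝔬 θ₀ δ₀ U) (w : ℕ × ι × (ℕ → κ)) (y y' : g.Site) :
    |(EK39OfOpsBlkVia 𝔬 rd d B₁ δ₁ π).kterm U w y y'| ≤ g.len y ^ (-(4 : ℝ)) * g.len y' ^ (-(d : ℝ)) *
      B9.walkFactor B₀ (θ₀ * c + 1) g.M (2 * ((1 - α) * δ₀)) ((EK39OfOpsBlkVia 𝔬 rd d B₁ δ₁ π).wlen w)
        ((EK39OfOpsBlkVia 𝔬 rd d B₁ δ₁ π).wdist w y y') := by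
  have h := kterm_EK39OfOpsBlk_le 𝔬 rd c d B₁ δ₁ δ₀ α θ₀ B₀ N U hc hδ₀ hα hα1 hθ₀ hB₀ hM hs h261 hl hf w (π y) (π y')
  have hvol : vol g d (π y') = vol g d y' := by unfold vol; rw [hπlen]
  have hwd : minLen g.dist (walkSetsBlk 𝔬 w.2.1 w.2.2) w.1 (π y) (π y') = minLen g.dist (walkSetsBlk 𝔬 w.2.1 w.2.2) w.1 y y' := by
    rw [minLen_congr_left g.dist (hπl y), minLen_congr_right g.dist (fun z => hπr z y')]
  change |blockKer 𝔬.blk (lprod (walkOpsBlk 𝔬 U w.2.1 w.2.2) w.1) (π y) (π y') / vol g d (π y')| ≤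
    g.len (π y) ^ (-(4 : ℝ)) * g.len (π y') ^ (-(d : ℝ)) *
      B9.walkFactor B₀ (θ₀ * c + 1) g.M (2 * ((1 - α) * δ₀)) w.1 (minLen g.dist (walkSetsBlk 𝔬 w.2.1 w.2.2) w.1 (π y) (π y')) at h
  rw [hvol, hπlen, hπlen, hwd] at h
  exact h

end OneMember

/-! ## §3 Row 15 at the datum read through `π`; rows 15 ∧ 16 at the definite (2.61) constant -/

section Family

variable {I : Type} {c35 : ℝ} {geo : I → B9.Geometry} {bg : I → B9.Backgrounds}
variable [∀ i, Fintype (geo i).Site] [∀ i, DecidableEq (geo i).Site]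
variable {X ι κ : I → Type} [∀ i, Fintype (ι i)] [∀ i, Fintype (X i)] [∀ i, DecidableEq (X i)]

/-- ★ **THEOREM 3.9 AS THE WHOLE PRINTED LEAF OVER THE CARRIER AT THE DATUM READ THROUGH `π`, (2.61) WITH GENERIC CONSTANTS** — the `π`-twin of
`B9Thm39WholeBlkFaces.thm39Printed_of_local348Blk` (same constants and thresholds), for representative maps preserving `len` and the distances
from∕to every site. [cite: Balaban1985BackgroundPropagators, Thm 3.9 (3.98)–(3.99) p.413 + (3.95)–(3.96) p.411 + (3.35) p.396; Balaban1984PropagatorsII, Lemma 2.1 (2.61) p.234 + (2.45)–(2.46) p.231] -/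
theorem thm39Printed_of_local348BlkVia (𝔬 : ∀ i, Ops39Blk (geo i) (bg i) (X i) (ι i) (κ i))
    (rd : ∀ i, WalkReading39 (bg i) (ι i) (κ i)) (π : ∀ i, (geo i).Site → (geo i).Site) (c c' : ℝ) (d : ℕ)
    (α α' r δ₀ θ₀ B₀ N a₁ M₁ ML : ℝ)
    (hc : 0 ≤ c) (hc' : 0 ≤ c') (h35 : 0 < c35) (hα : 0 ≤ α) (hα1 : α < 1) (hα' : α' ≤ 1) (hr : 0 ≤ r) (hrδ : r ≤ δ₀)
    (hδ₀ : 0 < δ₀) (hθ₀ : 0 ≤ θ₀) (hB₀ : 0 < B₀) (hN : 0 ≤ N) (ha₁ : 0 < a₁) (hM₁ : 0 < M₁)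
    (hst : ∀ i, StaticOK39Blk (𝔬 i) N) (hloc : ∀ i, Locality39Blk (𝔬 i) (rd i))
    (hπlen : ∀ (i : I) (y : (geo i).Site), (geo i).len (π i y) = (geo i).len y)
    (hπl : ∀ (i : I) (y z : (geo i).Site), (geo i).dist (π i y) z = (geo i).dist y z)
    (hπr : ∀ (i : I) (z y : (geo i).Site), (geo i).dist z (π i y) = (geo i).dist z y)
    (h261 : ∀ i, ML ≤ (geo i).M → Ineq261With c (b6 (geo i)) δ₀ α ∧ Ineq261With c' (b6 (geo i)) r α')
    (h39 : ∀ i, M₁ ≤ (geo i).M → ∀ α₀ : ℝ, 0 < α₀ → c35 * (geo i).M * α₀ ≤ a₁ →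
      ∀ U : (bg i).Cfg, (bg i).Reg335 c35 α₀ U →
        Local348Blk (𝔬 i) B₀ δ₀ U ∧ Identities395Blk (𝔬 i) U ∧ Small285Blk (𝔬 i) θ₀ r U ∧ Factors389Blk (𝔬 i) θ₀ δ₀ U) :
    B9.Thm39Printed d c35 geo bg
      (fun i => EK39OfOpsBlkVia (𝔬 i) (rd i) d (2 * (N * B₀) * c') ((1 - α') * r) (π i)) := by
  have hcpos : 0 < θ₀ * c + 1 := by
    have h0 : 0 ≤ θ₀ * c := mul_nonneg hθ₀ hc
    linarith
  refine ⟨max M₁ (max ML (2 * θ₀ * c')), a₁ / c35, 2 * ((1 - α) * δ₀), B₀, θ₀ * c + 1,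
    lt_max_of_lt_left hM₁, div_pos ha₁ h35, by nlinarith, hB₀, hcpos, ?_⟩
  intro i hM α₀ hα₀ hMa U hU
  have hM₁i : M₁ ≤ (geo i).M := le_trans (le_max_left _ _) hM
  have hMLi : ML ≤ (geo i).M := le_trans (le_trans (le_max_left _ _) (le_max_right _ _)) hM
  have hbig : 2 * θ₀ * c' ≤ (geo i).M := le_trans (le_trans (le_max_right _ _) (le_max_right _ _)) hM
  have hMpos : 0 < (geo i).M := lt_of_lt_of_le hM₁ hM₁i
  have ha : c35 * (geo i).M * α₀ ≤ a₁ := by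
    have h1 : (geo i).M * α₀ * c35 ≤ a₁ := (le_div_iff₀ h35).mp hMa
    calc c35 * (geo i).M * α₀ = (geo i).M * α₀ * c35 := by ring
      _ ≤ a₁ := h1
  obtain ⟨hl, hi, hR, hf⟩ := h39 i hM₁i α₀ hα₀ ha U hU
  obtain ⟨h261a, h261b⟩ := h261 i hMLi
  refine ⟨?_, fun w y y' => ⟨locDep_EK39OfOpsBlkVia (𝔬 i) (rd i) d _ _ (π i) (hloc i) U w, ?_⟩⟩
  · exact conv348Blk_of_local348 (𝔬 i) c' r α' θ₀ B₀ δ₀ N U hc' hr hrδ hα' hθ₀ hB₀.le hN hMpos hbig (hst i) h261b hl hi hR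
  · exact kterm_EK39OfOpsBlkVia_le (𝔬 i) (rd i) c d _ _ δ₀ α θ₀ B₀ N (π i) U hc hδ₀.le hα hα1.le hθ₀ hB₀.le hMpos (hst i)
      h261a (hπlen i) (hπl i) (hπr i) hl hf w y y'

/-- ★ **ROW 15 AT THE DEFINITE DATUM READ THROUGH `π`**, [4] Lemma 2.1 (2.61) supplied by `RowSum261 geo` at both rates.
[cite: Balaban1985BackgroundPropagators, Thm 3.9 (3.98)–(3.99) p.413; Balaban1984PropagatorsII, Lemma 2.1 (2.61) p.234] -/
theorem thm39Printed_rowConst261BlkVia_of_rowSum261 (𝔬 : ∀ i, Ops39Blk (geo i) (bg i) (X i) (ι i) (κ i))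
    (rd : ∀ i, WalkReading39 (bg i) (ι i) (κ i)) (π : ∀ i, (geo i).Site → (geo i).Site) (d : ℕ) (α α' r δ₀ θ₀ B₀ N a₁ M₁ : ℝ)
    (h35 : 0 < c35) (hα : 0 < α) (hα1 : α < 1) (hα'0 : 0 < α') (hα' : α' ≤ 1) (hr : 0 < r) (hrδ : r ≤ δ₀)
    (hθ₀ : 0 ≤ θ₀) (hB₀ : 0 < B₀) (hN : 0 ≤ N) (ha₁ : 0 < a₁) (hM₁ : 0 < M₁)
    (hst : ∀ i, StaticOK39Blk (𝔬 i) N) (hloc : ∀ i, Locality39Blk (𝔬 i) (rd i)) (hrow : B9Ineq349Whole.RowSum261 geo)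
    (hπlen : ∀ (i : I) (y : (geo i).Site), (geo i).len (π i y) = (geo i).len y)
    (hπl : ∀ (i : I) (y z : (geo i).Site), (geo i).dist (π i y) z = (geo i).dist y z)
    (hπr : ∀ (i : I) (z y : (geo i).Site), (geo i).dist z (π i y) = (geo i).dist z y)
    (h39 : ∀ i, M₁ ≤ (geo i).M → ∀ α₀ : ℝ, 0 < α₀ → c35 * (geo i).M * α₀ ≤ a₁ →
      ∀ U : (bg i).Cfg, (bg i).Reg335 c35 α₀ U →
        Local348Blk (𝔬 i) B₀ δ₀ U ∧ Identities395Blk (𝔬 i) U ∧ Small285Blk (𝔬 i) θ₀ r U ∧ Factors389Blk (𝔬 i) θ₀ δ₀ U) :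
    B9.Thm39Printed d c35 geo bg
      (fun i => EK39OfOpsBlkVia (𝔬 i) (rd i) d (2 * (N * B₀) * B9RowSum261DefiniteFaces.rowConst261 geo (α' * r))
        ((1 - α') * r) (π i)) := by
  have hδ₀ : 0 < δ₀ := lt_of_lt_of_le hr hrδ
  obtain ⟨ML, h261⟩ := B9RowSum261DefiniteFaces.ineq261With_pair_rowConst261_of_rowSum261 (geo := geo) (fun _ => (0 : ℝ))
    (fun _ => True) (mul_pos hα hδ₀) (mul_pos hα'0 hr) hrow
  exact thm39Printed_of_local348BlkVia 𝔬 rd π (B9RowSum261DefiniteFaces.rowConst261 geo (α * δ₀))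
    (B9RowSum261DefiniteFaces.rowConst261 geo (α' * r)) d α α' r δ₀ θ₀ B₀ N a₁ M₁ ML
    (B9RowSum261DefiniteFaces.rowConst261_nonneg geo _) (B9RowSum261DefiniteFaces.rowConst261_nonneg geo _) h35 hα.le hα1
    hα' hr.le hrδ hδ₀ hθ₀ hB₀ hN ha₁ hM₁ hst hloc hπlen hπl hπr h261 h39

/-- ★★ **ROWS 15 AND 16 AT THE DEFINITE DATUM READ THROUGH `π`, FROM `RowSum261` AND THE READING `KerReadsLeVia … (π i)`** — both the terms and the
carrier kernel read through the representatives; NO existential, NO (2.61) hypothesis. [cite: Balaban1985BackgroundPropagators, Thm 3.9 p.413 («This theorem implies Theorem 3.2») + Thm 3.2 (3.48) p.398; Balaban1984PropagatorsII, Lemma 2.1 (2.61) p.234 + p.248] -/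
theorem thm39_and_kernelSum_rowConst261BlkViaDatum_of_rowSum261 (𝔬 : ∀ i, Ops39Blk (geo i) (bg i) (X i) (ι i) (κ i))
    (rd : ∀ i, WalkReading39 (bg i) (ι i) (κ i)) (Cinv : ∀ i, B9.SiteKernel (geo i) (bg i)) (d : ℕ)
    (π : ∀ i, (geo i).Site → (geo i).Site) (α α' r δ₀ θ₀ B₀ N a₁ M₁ cR : ℝ)
    (h35 : 0 < c35) (hα : 0 < α) (hα1 : α < 1) (hα'0 : 0 < α') (hα'1 : α' < 1) (hr : 0 < r) (hrδ : r ≤ δ₀)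
    (hθ₀ : 0 ≤ θ₀) (hB₀ : 0 < B₀) (hN : 0 ≤ N) (ha₁ : 0 < a₁) (hM₁ : 0 < M₁) (hcR : 0 ≤ cR)
    (hst : ∀ i, StaticOK39Blk (𝔬 i) N) (hloc : ∀ i, Locality39Blk (𝔬 i) (rd i)) (hrow : B9Ineq349Whole.RowSum261 geo)
    (hπlen : ∀ (i : I) (y : (geo i).Site), (geo i).len (π i y) = (geo i).len y)
    (hπl : ∀ (i : I) (y z : (geo i).Site), (geo i).dist (π i y) z = (geo i).dist y z)
    (hπr : ∀ (i : I) (z y : (geo i).Site), (geo i).dist z (π i y) = (geo i).dist z y)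
    (hrd : ∀ i, KerReadsLeVia (𝔬 i) (Cinv i) d cR (π i))
    (h39 : ∀ i, M₁ ≤ (geo i).M → ∀ α₀ : ℝ, 0 < α₀ → c35 * (geo i).M * α₀ ≤ a₁ →
      ∀ U : (bg i).Cfg, (bg i).Reg335 c35 α₀ U →
        Local348Blk (𝔬 i) B₀ δ₀ U ∧ Identities395Blk (𝔬 i) U ∧ Small285Blk (𝔬 i) θ₀ r U ∧ Factors389Blk (𝔬 i) θ₀ δ₀ U) :
    B9.Thm39Printed d c35 geo bg
        (fun i => EK39OfOpsBlkVia (𝔬 i) (rd i) d (2 * (N * B₀) * B9RowSum261DefiniteFaces.rowConst261 geo (α' * r))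
          ((1 - α') * r) (π i)) ∧
      B9.RWKernelSumYields d geo bg
        (fun i => EK39OfOpsBlkVia (𝔬 i) (rd i) d (2 * (N * B₀) * B9RowSum261DefiniteFaces.rowConst261 geo (α' * r))
          ((1 - α') * r) (π i)) Cinv := by
  have hδ₁ : 0 < (1 - α') * r := mul_pos (by linarith) hr
  have hB₁ : 0 ≤ 2 * (N * B₀) * B9RowSum261DefiniteFaces.rowConst261 geo (α' * r) :=
    mul_nonneg (mul_nonneg zero_le_two (mul_nonneg hN hB₀.le)) (B9RowSum261DefiniteFaces.rowConst261_nonneg geo _)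
  refine ⟨thm39Printed_rowConst261BlkVia_of_rowSum261 𝔬 rd π d α α' r δ₀ θ₀ B₀ N a₁ M₁ h35 hα hα1 hα'0 hα'1.le hr hrδ hθ₀ hB₀
      hN ha₁ hM₁ hst hloc hrow hπlen hπl hπr h39, ?_⟩
  exact rwKernelSumYields_of_conv348BlkVia 𝔬 Cinv d π hB₁ hδ₁ hcR (fun i y => (hst i).lenpos y) hπlen
    (fun i y y' => by rw [hπl, hπr]) (fun _ _ h => h) hrd

/-- **PIN FORM**: for expansion data `EK i` EQUAL to the definite datum read through `π` (the knit's literal pin), rows 15 ∧ 16 about `EK`.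
[cite: Balaban1985BackgroundPropagators, Thm 3.9 (3.98)–(3.99) p.413 + Thm 3.2 (3.48) p.398] -/
theorem thm39_and_kernelSum_of_pin_rowConst261BlkViaDatum (𝔬 : ∀ i, Ops39Blk (geo i) (bg i) (X i) (ι i) (κ i))
    (rd : ∀ i, WalkReading39 (bg i) (ι i) (κ i)) (Cinv : ∀ i, B9.SiteKernel (geo i) (bg i)) (d : ℕ)
    (π : ∀ i, (geo i).Site → (geo i).Site) (α α' r δ₀ θ₀ B₀ N a₁ M₁ cR : ℝ)
    (h35 : 0 < c35) (hα : 0 < α) (hα1 : α < 1) (hα'0 : 0 < α') (hα'1 : α' < 1) (hr : 0 < r) (hrδ : r ≤ δ₀)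
    (hθ₀ : 0 ≤ θ₀) (hB₀ : 0 < B₀) (hN : 0 ≤ N) (ha₁ : 0 < a₁) (hM₁ : 0 < M₁) (hcR : 0 ≤ cR)
    (hst : ∀ i, StaticOK39Blk (𝔬 i) N) (hloc : ∀ i, Locality39Blk (𝔬 i) (rd i)) (hrow : B9Ineq349Whole.RowSum261 geo)
    (hπlen : ∀ (i : I) (y : (geo i).Site), (geo i).len (π i y) = (geo i).len y)
    (hπl : ∀ (i : I) (y z : (geo i).Site), (geo i).dist (π i y) z = (geo i).dist y z)
    (hπr : ∀ (i : I) (z y : (geo i).Site), (geo i).dist z (π i y) = (geo i).dist z y)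
    (hrd : ∀ i, KerReadsLeVia (𝔬 i) (Cinv i) d cR (π i))
    (h39 : ∀ i, M₁ ≤ (geo i).M → ∀ α₀ : ℝ, 0 < α₀ → c35 * (geo i).M * α₀ ≤ a₁ →
      ∀ U : (bg i).Cfg, (bg i).Reg335 c35 α₀ U →
        Local348Blk (𝔬 i) B₀ δ₀ U ∧ Identities395Blk (𝔬 i) U ∧ Small285Blk (𝔬 i) θ₀ r U ∧ Factors389Blk (𝔬 i) θ₀ δ₀ U)
    {EK : ∀ i, B9.RWKernelExpansion (geo i) (bg i)}
    (hEK : ∀ i, EK i = EK39OfOpsBlkVia (𝔬 i) (rd i) d (2 * (N * B₀) * B9RowSum261DefiniteFaces.rowConst261 geo (α' * r))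
      ((1 - α') * r) (π i)) :
    B9.Thm39Printed d c35 geo bg EK ∧ B9.RWKernelSumYields d geo bg EK Cinv := by
  obtain rfl : EK = fun i => EK39OfOpsBlkVia (𝔬 i) (rd i) d (2 * (N * B₀) * B9RowSum261DefiniteFaces.rowConst261 geo (α' * r))
      ((1 - α') * r) (π i) := funext hEK
  exact thm39_and_kernelSum_rowConst261BlkViaDatum_of_rowSum261 𝔬 rd Cinv d π α α' r δ₀ θ₀ B₀ N a₁ M₁ cR h35 hα hα1 hα'0 hα'1
    hr hrδ hθ₀ hB₀ hN ha₁ hM₁ hcR hst hloc hrow hπlen hπl hπr hrd h39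

/-- **THEOREM 3.2 AS TYPED at the pinned definite datum read through `π`** (p. 413: *"This theorem implies Theorem 3.2"*).
[cite: Balaban1985BackgroundPropagators, Thm 3.9 ⇒ Thm 3.2 p.413 + Thm 3.2 (3.48) p.398] -/
theorem thm32Printed_of_pin_rowConst261BlkViaDatum (𝔬 : ∀ i, Ops39Blk (geo i) (bg i) (X i) (ι i) (κ i))
    (rd : ∀ i, WalkReading39 (bg i) (ι i) (κ i)) (Cinv : ∀ i, B9.SiteKernel (geo i) (bg i)) (d : ℕ)
    (π : ∀ i, (geo i).Site → (geo i).Site) (α α' r δ₀ θ₀ B₀ N a₁ M₁ cR : ℝ)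
    (h35 : 0 < c35) (hα : 0 < α) (hα1 : α < 1) (hα'0 : 0 < α') (hα'1 : α' < 1) (hr : 0 < r) (hrδ : r ≤ δ₀)
    (hθ₀ : 0 ≤ θ₀) (hB₀ : 0 < B₀) (hN : 0 ≤ N) (ha₁ : 0 < a₁) (hM₁ : 0 < M₁) (hcR : 0 ≤ cR)
    (hst : ∀ i, StaticOK39Blk (𝔬 i) N) (hloc : ∀ i, Locality39Blk (𝔬 i) (rd i)) (hrow : B9Ineq349Whole.RowSum261 geo)
    (hπlen : ∀ (i : I) (y : (geo i).Site), (geo i).len (π i y) = (geo i).len y)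
    (hπl : ∀ (i : I) (y z : (geo i).Site), (geo i).dist (π i y) z = (geo i).dist y z)
    (hπr : ∀ (i : I) (z y : (geo i).Site), (geo i).dist z (π i y) = (geo i).dist z y)
    (hrd : ∀ i, KerReadsLeVia (𝔬 i) (Cinv i) d cR (π i))
    (h39 : ∀ i, M₁ ≤ (geo i).M → ∀ α₀ : ℝ, 0 < α₀ → c35 * (geo i).M * α₀ ≤ a₁ →
      ∀ U : (bg i).Cfg, (bg i).Reg335 c35 α₀ U →
        Local348Blk (𝔬 i) B₀ δ₀ U ∧ Identities395Blk (𝔬 i) U ∧ Small285Blk (𝔬 i) θ₀ r U ∧ Factors389Blk (𝔬 i) θ₀ δ₀ U)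
    {EK : ∀ i, B9.RWKernelExpansion (geo i) (bg i)}
    (hEK : ∀ i, EK i = EK39OfOpsBlkVia (𝔬 i) (rd i) d (2 * (N * B₀) * B9RowSum261DefiniteFaces.rowConst261 geo (α' * r))
      ((1 - α') * r) (π i)) :
    B9.Thm32Printed d c35 geo bg Cinv := by
  obtain ⟨h39P, hks⟩ := thm39_and_kernelSum_of_pin_rowConst261BlkViaDatum 𝔬 rd Cinv d π α α' r δ₀ θ₀ B₀ N a₁ M₁ cR h35 hα hα1
    hα'0 hα'1 hr hrδ hθ₀ hB₀ hN ha₁ hM₁ hcR hst hloc hrow hπlen hπl hπr hrd h39 hEK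
  exact B9.thm32_of_thm39 d c35 geo bg _ Cinv h39P hks

end Family

/-! ## §4 At def-Y's operator-layer signature over the members of record -/

section StageY

open B9PinMembersKLevelV1 B9PinCarriersKLevelV1 B9GeoLemma21KLevelV1

variable {d ℓ : ℕ} {hd : 1 ≤ d + 1} {hL : Odd (ℓ + 1) ∧ 1 < ℓ + 1} {b₀ b₁ : ℝ} {Mstar : ℕ}
variable {𝔸 : Type} [NormedRing 𝔸] [NormedAlgebra ℂ 𝔸] [CompleteSpace 𝔸] {G : Subgroup 𝔸ˣ}
variable (ops : ∀ x : MemberY d ℓ hd hL b₀ b₁ Mstar, OperatorLayerY d ℓ hd hL b₀ b₁ Mstar 𝔸 G x)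
variable [∀ x : MemberY d ℓ hd hL b₀ b₁ Mstar, Fintype (geo9Y x).Site]
  [∀ x : MemberY d ℓ hd hL b₀ b₁ Mstar, DecidableEq (geo9Y x).Site]
variable {c35 : ℝ} {X39 ι κ : MemberY d ℓ hd hL b₀ b₁ Mstar → Type} [∀ x, Fintype (ι x)] [∀ x, Fintype (X39 x)]
  [∀ x, DecidableEq (X39 x)]

/-- ★ **ROWS 15 ∧ 16 OF THE N06 KNIT FROM THE LITERAL CARRIER PIN AT THE DEFINITE DATUM READ THROUGH `π`**: over def-Y's operator layer `ops`, carrier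
letters `𝔬39 x`, a representative map `π x` preserving `len` and the distances from∕to every site, the pin `(ops x).EK39 = EK39OfOpsBlkVia (𝔬39 x) (rd39 x) dd
(2(N·B₀)·rowConst261 geo9Y (α′r)) ((1−α′)r) (π x)` and the reading `KerReadsLeVia … cR (π x)`: `B9.Thm39Printed …` ∧ `B9.RWKernelSumYields …`; [4] (2.61) at
both rates is n06-i's `rowSum261_geo9Y` BY NAME. [cite: Balaban1985BackgroundPropagators, Thm 3.9 (3.98)–(3.99) p.413 + Thm 3.2 (3.48) p.398; Balaban1984PropagatorsII, Lemma 2.1 (2.61) p.234 + p.248] -/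
theorem t39_hksum_of_pin_rowConst261BlkViaDatum
    (𝔬39 : ∀ x : MemberY d ℓ hd hL b₀ b₁ Mstar, Ops39Blk (geo9Y x) (bg9Y 𝔸 G x) (X39 x) (ι x) (κ x))
    (rd39 : ∀ x : MemberY d ℓ hd hL b₀ b₁ Mstar, WalkReading39 (bg9Y 𝔸 G x) (ι x) (κ x))
    (π : ∀ x : MemberY d ℓ hd hL b₀ b₁ Mstar, (geo9Y x).Site → (geo9Y x).Site)
    (dd : ℕ) (α α' r δ₀ θ₀ B₀ N a₁ M₁ cR : ℝ)
    (h35 : 0 < c35) (hα : 0 < α) (hα1 : α < 1) (hα'0 : 0 < α') (hα'1 : α' < 1) (hr : 0 < r) (hrδ : r ≤ δ₀)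
    (hθ₀ : 0 ≤ θ₀) (hB₀ : 0 < B₀) (hN : 0 ≤ N) (ha₁ : 0 < a₁) (hM₁ : 0 < M₁) (hcR : 0 ≤ cR)
    (hst : ∀ x, StaticOK39Blk (𝔬39 x) N) (hloc : ∀ x, Locality39Blk (𝔬39 x) (rd39 x))
    (hπlen : ∀ (x : MemberY d ℓ hd hL b₀ b₁ Mstar) (y : (geo9Y x).Site), (geo9Y x).len (π x y) = (geo9Y x).len y)
    (hπl : ∀ (x : MemberY d ℓ hd hL b₀ b₁ Mstar) (y z : (geo9Y x).Site), (geo9Y x).dist (π x y) z = (geo9Y x).dist y z)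
    (hπr : ∀ (x : MemberY d ℓ hd hL b₀ b₁ Mstar) (z y : (geo9Y x).Site), (geo9Y x).dist z (π x y) = (geo9Y x).dist z y)
    (h39 : ∀ x : MemberY d ℓ hd hL b₀ b₁ Mstar, M₁ ≤ (geo9Y x).M → ∀ α₀ : ℝ, 0 < α₀ → c35 * (geo9Y x).M * α₀ ≤ a₁ →
      ∀ U : (bg9Y 𝔸 G x).Cfg, (bg9Y 𝔸 G x).Reg335 c35 α₀ U →
        Local348Blk (𝔬39 x) B₀ δ₀ U ∧ Identities395Blk (𝔬39 x) U ∧ Small285Blk (𝔬39 x) θ₀ r U ∧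
          Factors389Blk (𝔬39 x) θ₀ δ₀ U)
    (hEK39 : ∀ x : MemberY d ℓ hd hL b₀ b₁ Mstar, (ops x).EK39 =
      EK39OfOpsBlkVia (𝔬39 x) (rd39 x) dd
        (2 * (N * B₀) * B9RowSum261DefiniteFaces.rowConst261
          (geo9Y (d := d) (ℓ := ℓ) (hd := hd) (hL := hL) (b₀ := b₀) (b₁ := b₁) (Mstar := Mstar)) (α' * r)) ((1 - α') * r) (π x))
    (hrdC : ∀ x : MemberY d ℓ hd hL b₀ b₁ Mstar, KerReadsLeVia (𝔬39 x) (ops x).Cinv dd cR (π x)) :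
    B9.Thm39Printed dd c35 geo9Y (bg9Y 𝔸 G) (fun x => (ops x).EK39) ∧
      B9.RWKernelSumYields dd geo9Y (bg9Y 𝔸 G) (fun x => (ops x).EK39) (fun x => (ops x).Cinv) :=
  thm39_and_kernelSum_of_pin_rowConst261BlkViaDatum 𝔬39 rd39 (fun x => (ops x).Cinv) dd π α α' r δ₀ θ₀ B₀ N a₁ M₁ cR h35 hα hα1
    hα'0 hα'1 hr hrδ hθ₀ hB₀ hN ha₁ hM₁ hcR hst hloc rowSum261_geo9Y hπlen hπl hπr hrdC h39 hEK39

end StageY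

end

end Literature.MathematicalPhysics.QuantumFieldTheory.Balaban1983to89.B9Thm39WholeBlkViaDatum
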